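import Summits.Ventures.LatticeQCDFlow.Scaling.ExchangeCostLaw

/-!
HONEST FRAMING: exact (Metropolis-corrected) sampling algorithms for lattice gauge theory; figures
of merit are autocorrelation/cost numbers at stated couplings and volumes; no continuum-physics
claim.

# AllocationCostLaw — THE UNIVERSAL COST FLOOR OF AN EXCHANGE SCHEME OVER SECTOR-IDLE COLD REPLICAS: WHATEVER THE
# SWAP GRAPH, THE PROPOSAL LAW, THE (SECTOR-PRESERVING) MAPS, THE SWAP FRACTION `t` AND THE UPDATE ALLOCATION `w`,
# ONE RELAXATION TIME COSTS AT LEAST `2K·v·κ_s + (K+1)·v·κ_0/Q_0(A,Aᶜ)` — `K` SWAPS PLUS `K/Q_0` HOT UPDATES —, AND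
# EVERY UNIT OF COST SPENT UPDATING COLD REPLICAS IS ADDED TO THE BILL WITHOUT RETURN (lean-2 GEN-23, ours)

Venture-side (OURS).  Cell `lqcd-flow` (pub-lqcd), unit `pub-lqcd-lean-2-g23`, 2026-08-26.  Chapter K, file 7: the
cost accounting of `Scaling/ExchangeCostLaw` (K5, hot-only schemes) for EVERY allocation of the updates.  Scheme
`P = t·ptGraphSwap μ e φ + (1−t)·prodKernel w M` on any edge list `e` (distinct endpoints) with sector-preserving maps
`φ_r(A) = A`; a step costs `t·κ_s + (1−t)·Σ_k w_k κ_k` on average (`κ_s` a swap test, `κ_k` one update of replica `k`,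
all `≥ 0`); cold replicas are SECTOR-IDLE for a set `A`: `w_k·Q_k(A,Aᶜ) = 0` for `k ≠ 0` (frozen in the sector under
their own update — the metastable situation the exchange is meant to cure — or never updated); `μ_k(A)μ_k(Aᶜ) ≥ v > 0`
for all `k`.

## What is proved

* §1 **`idleScheme_spectralGap_le_swap`** — `Gap(P) ≤ t/(2K·v)` (K1's diluted handover with `h ≤ m` and
  `min{μ_0(A),μ_0(Aᶜ)} ≤ ½`); **`idleScheme_spectralGap_le_hot`** — `Gap(P) ≤ (1−t)·w_0·Q_0(A,Aᶜ)/((K+1)·v)` (H1's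
  sector count, only the hot update mints labels).
* §2 **`idleScheme_gap_mul_cost_le` (THE UNIVERSAL COST FLOOR):** for all `0 ≤ t ≤ 1`, probability vectors `w`,
  costs `κ_s, κ_k ≥ 0`:
  **`Gap(P)·(2K·v·κ_s + (K+1)·v·κ_0/Q_0(A,Aᶜ)) ≤ t·κ_s + (1−t)·w_0·κ_0 ≤ t·κ_s + (1−t)·Σ_k w_k κ_k`** — the cost of one
  relaxation time, `(mean step cost)/Gap`, is at least `2Kv·κ_s + (K+1)v·κ_0/Q_0(A,Aᶜ)`, and the cold updates' share
  `(1−t)Σ_{k≠0} w_kκ_k` of the step cost buys nothing.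
* §3 **`idleScheme_relaxationCost_ge`** — the same as a lower bound on `(t·κ_s + (1−t)·Σ_k w_kκ_k)/Gap(P)`.

Reading (no numerics implied): together with `Scaling/ExchangeCostLaw` (the hot-only balanced hub pays at most
`(6K·κ_s + 14K·κ_0/γ₀)/p` per relaxation, `γ₀μ_0(A)μ_0(Aᶜ) ≤ Q_0(A,Aᶜ)`), the bill of an exact exchange sampler over
`K` metastable replicas is ORDER `K` SWAP TESTS PLUS ORDER `K` HOT RELAXATION TIMES, from both sides, for every design
choice the scheme class leaves open; spending on the cold replicas' own updates cannot lower it while they do not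
cross sectors.  NOT CLAIMED: cold replicas relaxing within sectors for observables finer than the sector (then
`Scaling/HubModeAllocation`); amortised training costs; parallel hardware; anything measured.  Literature grade (cell
rule): OWN COMPOSITION (K1 + H1 + arithmetic); nothing cited as a fact; no new bib keys.
-/

noncomputable section

open Finset Function
open Literature.Probability.MarkovChains

namespace Summit.Ventures.LatticeQCDFlow.Scaling

variable {S : Type*} [Fintype S] [DecidableEq S] {K m : ℕ} {μ : Fin (K + 1) → S → ℝ}
  {M : Fin (K + 1) → S → S → ℝ} {w : Fin (K + 1) → ℝ} {t : ℝ} {e : Fin m → Fin (K + 1) × Fin (K + 1)}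
  {φ : Fin m → Equiv.Perm S}

section Idle
variable [Nontrivial S] (hK : 1 ≤ K) (hm : 1 ≤ m) (he : ∀ r, (e r).1 ≠ (e r).2) (hμ : ∀ k x, 0 < μ k x)
  (hμ1 : ∀ k, ∑ u, μ k u = 1) (hM : ∀ k, IsRowStochastic (M k)) (hMrev : ∀ k, DetailedBalance (μ k) (M k))
  (hw0 : ∀ k, 0 ≤ w k) (hw1 : ∑ k, w k = 1) (ht0 : 0 ≤ t) (ht1 : t ≤ 1) {A : Finset S}
  (hφA : ∀ r u, φ r u ∈ A ↔ u ∈ A) {v : ℝ} (hvpos : 0 < v)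
  (hv : ∀ k : Fin (K + 1), v ≤ (∑ u ∈ A, μ k u) * ∑ u ∈ Aᶜ, μ k u)
  (hidle : ∀ k : Fin (K + 1), k ≠ 0 → w k * edgeMeasure (μ k) (M k) A Aᶜ = 0)
include hK hm he hμ hμ1 hM hMrev hw0 hw1 ht0 ht1 hφA hvpos hv hidle

/-! ## §1 The two throughput ceilings for every allocation -/

/-- **`Gap(P) ≤ t/(2K·v)` FOR EVERY SWAP GRAPH, MAPS AND ALLOCATION** over sector-idle cold replicas: the diluted handover
ceiling with `h ≤ m` and `min{μ_0(A), μ_0(Aᶜ)} ≤ ½`. [ours] -/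
theorem idleScheme_spectralGap_le_swap :
    spectralGap (tensorFun μ) (fun x y : Fin (K + 1) → S => t * ptGraphSwap μ e φ x y + (1 - t) * prodKernel w M x y)
      ≤ t / (2 * K * v) := by
  have hKpos : (0 : ℝ) < K := Nat.cast_pos.mpr (by omega)
  have hmpos : (0 : ℝ) < m := Nat.cast_pos.mpr (by omega)
  have h := dilutedHandover_spectralGap_le hK hm he hμ hμ1 hM hMrev hw0 hw1 ht0 ht1 hφA hvpos (fun k _ => hv k) hidle
  refine h.trans ?_
  have hh : ((univ.filter fun r : Fin m => (e r).1 = 0 ∨ (e r).2 = 0).card : ℝ) ≤ m := by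
    exact_mod_cast (Finset.card_filter_le _ _).trans (by rw [Finset.card_univ, Fintype.card_fin])
  have hmin : min (∑ u ∈ A, μ 0 u) (∑ u ∈ Aᶜ, μ 0 u) ≤ 1 / 2 := by
    have hsum : ∑ u ∈ A, μ 0 u + ∑ u ∈ Aᶜ, μ 0 u = 1 := by rw [Finset.sum_add_sum_compl, hμ1 0]
    rcases le_total (∑ u ∈ A, μ 0 u) (∑ u ∈ Aᶜ, μ 0 u) with hle | hle
    · rw [min_eq_left hle]; linarith
    · rw [min_eq_right hle]; linarith
  have hmin0 : 0 ≤ min (∑ u ∈ A, μ 0 u) (∑ u ∈ Aᶜ, μ 0 u) :=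
    le_min (sum_nonneg fun u _ => (hμ 0 u).le) (sum_nonneg fun u _ => (hμ 0 u).le)
  rw [div_le_div_iff₀ (by positivity) (by positivity)]
  calc t * ((univ.filter fun r : Fin m => (e r).1 = 0 ∨ (e r).2 = 0).card : ℝ)
          * min (∑ u ∈ A, μ 0 u) (∑ u ∈ Aᶜ, μ 0 u) * (2 * K * v)
      ≤ t * m * (1 / 2) * (2 * K * v) := by
        have := mul_le_mul hh hmin hmin0 hmpos.le
        have h2 : 0 ≤ t * (2 * K * v) := by positivity
        nlinarith
    _ = t * (m * K * v) := by ring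

omit hK hm in
/-- **`Gap(P) ≤ (1−t)·w_0·Q_0(A,Aᶜ)/((K+1)·v)` FOR EVERY SWAP GRAPH, MAPS AND ALLOCATION** over sector-idle cold
replicas: the sector count is invisible to every exchange, and only the hot update mints labels. [ours] -/
theorem idleScheme_spectralGap_le_hot :
    spectralGap (tensorFun μ) (fun x y : Fin (K + 1) → S => t * ptGraphSwap μ e φ x y + (1 - t) * prodKernel w M x y)
      ≤ (1 - t) * (w 0 * edgeMeasure (μ 0) (M 0) A Aᶜ) / (((K : ℝ) + 1) * v) := by
  have hQ := ptGraphSwap_isRowStochastic (e := e) (φ := φ) hμ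
  have hQrev := ptGraphSwap_detailedBalance (e := e) (φ := φ) hμ
  have hQA := ptGraphSwap_sectorCount_eq (μ := μ) he hμ hφA
  have hVge := allSectorMass_ge (μ := μ) hv
  have hVpos : 0 < ∑ k : Fin (K + 1), (∑ u ∈ A, μ k u) * ∑ u ∈ Aᶜ, μ k u :=
    lt_of_lt_of_le (mul_pos (by positivity) hvpos) hVge
  have h := weightedScheme_spectralGap_le_sectorCount (w := w) hμ hμ1 hM hMrev hw0 hw1 ht0 ht1 hQ hQrev hQA hVpos
  have hsum : ∑ k : Fin (K + 1), w k * edgeMeasure (μ k) (M k) A Aᶜ = w 0 * edgeMeasure (μ 0) (M 0) A Aᶜ := by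
    rw [Finset.sum_eq_single (0 : Fin (K + 1)) (fun k _ hk => hidle k hk) (fun h => absurd (mem_univ _) h)]
  rw [hsum] at h
  have hnum : 0 ≤ (1 - t) * (w 0 * edgeMeasure (μ 0) (M 0) A Aᶜ) :=
    mul_nonneg (by linarith) (mul_nonneg (hw0 0) (edgeMeasure_nonneg (fun u => (hμ 0 u).le) (hM 0).1 A Aᶜ))
  exact h.trans (div_le_div_of_nonneg_left hnum (by positivity) hVge)

/-! ## §2 The universal cost floor -/

/-- **THE UNIVERSAL COST FLOOR:** costs `κ_s ≥ 0` (a swap step) and `κ_k ≥ 0` (an update of replica `k`),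
`Q_0(A,Aᶜ) > 0`; for every swap graph, sector-preserving maps, swap fraction and allocation over sector-idle cold
replicas: **`Gap(P)·(2K·v·κ_s + (K+1)·v·κ_0/Q_0(A,Aᶜ)) ≤ t·κ_s + (1−t)·Σ_k w_k κ_k`** — and already
`≤ t·κ_s + (1−t)·w_0·κ_0`: the cold updates' cost is pure overhead. [ours] -/
theorem idleScheme_gap_mul_cost_le (hQ0 : 0 < edgeMeasure (μ 0) (M 0) A Aᶜ) {κs : ℝ} (hκs : 0 ≤ κs)
    {κ : Fin (K + 1) → ℝ} (hκ : ∀ k, 0 ≤ κ k) :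
    spectralGap (tensorFun μ) (fun x y : Fin (K + 1) → S => t * ptGraphSwap μ e φ x y + (1 - t) * prodKernel w M x y)
        * (2 * K * v * κs + ((K : ℝ) + 1) * v * κ 0 / edgeMeasure (μ 0) (M 0) A Aᶜ)
      ≤ t * κs + (1 - t) * (w 0 * κ 0)
    ∧ t * κs + (1 - t) * (w 0 * κ 0) ≤ t * κs + (1 - t) * ∑ k, w k * κ k := by
  have hKpos : (0 : ℝ) < K := Nat.cast_pos.mpr (by omega)
  set G := spectralGap (tensorFun μ) (fun x y : Fin (K + 1) → S =>
    t * ptGraphSwap μ e φ x y + (1 - t) * prodKernel w M x y) with hG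
  have h1 := idleScheme_spectralGap_le_swap hK hm he hμ hμ1 hM hMrev hw0 hw1 ht0 ht1 hφA hvpos hv hidle
  have h2 := idleScheme_spectralGap_le_hot he hμ hμ1 hM hMrev hw0 hw1 ht0 ht1 hφA hvpos hv hidle
  rw [← hG] at h1 h2
  refine ⟨?_, ?_⟩
  · have e1 : G * (2 * K * v * κs) ≤ t * κs := by
      have := mul_le_mul_of_nonneg_right h1 (by positivity : 0 ≤ 2 * K * v * κs)
      calc G * (2 * K * v * κs) ≤ t / (2 * K * v) * (2 * K * v * κs) := this
        _ = t * κs := by field_simp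
    have e2 : G * (((K : ℝ) + 1) * v * κ 0 / edgeMeasure (μ 0) (M 0) A Aᶜ) ≤ (1 - t) * (w 0 * κ 0) := by
      have := mul_le_mul_of_nonneg_right h2
        (by have := hκ 0; positivity : 0 ≤ ((K : ℝ) + 1) * v * κ 0 / edgeMeasure (μ 0) (M 0) A Aᶜ)
      calc G * (((K : ℝ) + 1) * v * κ 0 / edgeMeasure (μ 0) (M 0) A Aᶜ)
          ≤ (1 - t) * (w 0 * edgeMeasure (μ 0) (M 0) A Aᶜ) / (((K : ℝ) + 1) * v)
              * (((K : ℝ) + 1) * v * κ 0 / edgeMeasure (μ 0) (M 0) A Aᶜ) := this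
        _ = (1 - t) * (w 0 * κ 0) := by field_simp
    rw [mul_add]
    exact add_le_add e1 e2
  · have hle : w 0 * κ 0 ≤ ∑ k, w k * κ k :=
      Finset.single_le_sum (f := fun k => w k * κ k) (fun k _ => mul_nonneg (hw0 k) (hκ k)) (mem_univ 0)
    have h1t : 0 ≤ 1 - t := by linarith
    nlinarith

/-! ## §3 As a bound on the cost of a relaxation time -/

/-- **ONE RELAXATION TIME COSTS AT LEAST `2K·v·κ_s + (K+1)·v·κ_0/Q_0(A,Aᶜ)`:** if `Gap(P) > 0`,
`2K·v·κ_s + (K+1)·v·κ_0/Q_0(A,Aᶜ) ≤ (t·κ_s + (1−t)·Σ_k w_kκ_k)/Gap(P)`. [ours] -/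
theorem idleScheme_relaxationCost_ge (hQ0 : 0 < edgeMeasure (μ 0) (M 0) A Aᶜ) {κs : ℝ} (hκs : 0 ≤ κs)
    {κ : Fin (K + 1) → ℝ} (hκ : ∀ k, 0 ≤ κ k)
    (hgap : 0 < spectralGap (tensorFun μ) (fun x y : Fin (K + 1) → S =>
      t * ptGraphSwap μ e φ x y + (1 - t) * prodKernel w M x y)) :
    2 * K * v * κs + ((K : ℝ) + 1) * v * κ 0 / edgeMeasure (μ 0) (M 0) A Aᶜ
      ≤ (t * κs + (1 - t) * ∑ k, w k * κ k)
          / spectralGap (tensorFun μ) (fun x y : Fin (K + 1) → S =>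
              t * ptGraphSwap μ e φ x y + (1 - t) * prodKernel w M x y) := by
  obtain ⟨h1, h2⟩ := idleScheme_gap_mul_cost_le hK hm he hμ hμ1 hM hMrev hw0 hw1 ht0 ht1 hφA hvpos hv hidle hQ0 hκs hκ
  rw [le_div_iff₀ hgap, mul_comm]
  exact h1.trans h2

end Idle

end Summit.Ventures.LatticeQCDFlow.Scaling

end
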